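import Summits.HodgeConjecture.HodgeConjecture.Theses.NoetherLefschetzOneUp
import Literature.AlgebraicGeometry.HodgeTheory.HodgeTypeConjugation
import Literature.AlgebraicGeometry.HodgeTheory.AlgebraicClassesHodgeTypeHolds
import Literature.AlgebraicGeometry.Motives.FiberNetExistence

/-!
# Crux `K3TypeNets` (stmt-HodgeConjecture-11600) — ALTERNATIVE line `picard-dichotomy` (strategist)

Route `HodgeConjecture/NoetherLefschetzOneUp`, crux #2 `K3TypeNets`: for every smooth projective fourfold
`X` and surjective `f : X ⟶ ℙ²_ℂ` whose fibres over the `ℂ`-points off a proper Zariski-closed `T ⊊ ℙ²`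
are smooth projective surfaces of geometric genus `h^{2,0} = 1`, the span of the rational
`(2,2)`-classes of `X` lies in `algebraicClasses X 2 ⊔ V_f`, `V_f` the span of the rational
`(2,2)`-classes dying on `X ∖ f⁻¹C` for some Zariski-closed `C ⊊ ℙ²`.

Strategist line by `planner-cstrat-stmt-HodgeConjecture-11600-s2-0` (2026-08-17), published with
`ledger crux write … Lines/picard-dichotomy.lean` and NOT skeleton-registered (registering would replace
the lead's live skeleton `Lines/birth.lean` v2 — `ledger skeleton check` has no alternative-line mode in
this CLI; the lead may adopt it at a cycle boundary by checking it from its own work area). SIX named stubs;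
`sorry` lives ONLY inside the six `stub_*` theorems of §1; the kernel-checked composition `K3TypeNets_of`
(§3) concludes `Summit.HodgeConjecture.HodgeConjecture.Theses.NoetherLefschetzOneUp.K3TypeNets` BY NAME.

## What differs from the live line (birth v2) and why

The live line cuts along the Leray edge (S1, S2a, S2b — theorems) and then by the IRREGULARITY of the
fibres (S3 regular / S4 irregular). This line keeps S1, S2a, S2b VERBATIM (same names, same statements: a
proof landed `--supports` for either line serves both) and cuts the fibre-trivial Hodge classes FIRST along
the one dichotomy that decides whether the route's mechanism has any supply at all — the constancy of the
PICARD NUMBER `ρ(X_s) = dim_ℂ span{rational (1,1)-classes of X_s}` of the fibres over the smooth open `U`: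

* `stub_isogenySector` (S3c) — `ρ` CONSTANT on `U(ℂ)` (any regularity). Then there is no Noether–Lefschetz
  point in `U`, the period map of the weight-two K3-type variation is constant (Green's density criterion,
  Voisin II Prop. 5.20, read backwards: `h^{0,2} = 1` and a non-constant period map force a dense NL
  locus), the transcendental variation has finite monodromy and is CONSTANT (`= T₀`) on a finite étale
  cover `U'`, and the Hodge classes of the undischarged Leray piece are morphisms of Hodge structures
  `T₀ → gr^W_2 H²(U')`. The NL-Gysin supply is EMPTY; only correspondences finite over the base
  (multisections) can carry the classes. This sector contains, via bi-double covers
  `X = res((S × B)/(ι × τ)) → B/τ = ℙ²` (S a K3 with a non-symplectic involution, B ANY double plane: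
  `(T(S) ⊗ T(B))^{ι ⊗ τ} = T(S) ⊗ T(B)`), the algebraicity of every Hodge morphism `T(S) → T(B)` — known
  for Hodge isometries (Buskin 2019 = tree fact `Surfaces.Buskin2019_hodgeIsometry_algebraic`; Huybrechts
  2019; CM-span proved in `Motives/HodgeStructureK3TypeIsometrySpan`), OPEN for similarities of non-square
  multiplier and for real multiplication (Varesco 2023). It is a REGULAR-fibre phenomenon: the live S3
  contains it silently.
* `stub_nlSupportRegularJumping` (S3j) / `stub_nlSupportIrregularJumping` (S4j) — the live S3 / S4 with
  the extra hypothesis "two fibres over `U(ℂ)` have different Picard numbers": a Picard jump in `U` is an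
  NL point, so the period map is non-constant and — `h^{2,0} = 1 < 2 = dim ℙ²` — NL CURVES exist and are
  analytically dense (Green 1989; Voisin II Prop. 5.20; Oguiso 2003). This is exactly the supply the route
  header ("NL curves dense by Green's condition") assumed; the statements are otherwise verbatim S3 / S4.

Composition `K3TypeNets_of` (§3, no `sorry`) = the live composition with one more case split: S1; the
tautological surface net and `U := Tᶜ ⊓ smoothBase`; `span_le`; calibration by S2a at one point and
transport by S2b; `by_cases` Picard-constancy on `U(ℂ)` → S3c; else `push Not` gives the jump and
`by_cases` regularity → S3j / S4j; the residual is a generator of `V_f`; reassemble.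

## References

* [Arapura2022] D. Arapura, Pacific J. Math. 319 (2022) 233–258 = arXiv:2103.05038, Cor. 1.4, Rmk. 1.6.
* [VoisinHodgeII2003] C. Voisin, *Hodge Theory and Complex Algebraic Geometry II*, Prop. 5.20 (Green's
  density criterion), Prop. 9.21, Prop. 10.26. [VoisinHodgeI2002] Thm. 6.25, Thm. 9.3.
* [Green1989NLComponents] M. Green, J. Differential Geom. 29 (1989). [Oguiso2003] K. Oguiso, J. Algebraic
  Geom. 12 (2003) 405–433.
* [Buskin2019] N. Buskin, J. reine angew. Math. 755 (2019), Thm. 1.1 = arXiv:1510.02852. [Huybrechts2019]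
  D. Huybrechts, Comment. Math. Helv. 94 (2019), Thm. 0.2, Rem. 3.3. [Markman2024] arXiv:2204.00516.
  [Varesco2023] M. Varesco, Math. Z. (2023) = arXiv:2304.02519, Introduction, Thm. 1.
* [VanGeemen2008RM, §3] [Huybrechts2016K3, §3.3.5] [Garcia2016] [Kollar1986] [DeligneHodgeIII1974, 8.2.8]
  — as in `Lines/birth.md`.
-/

noncomputable section

set_option linter.dupNamespace false

open CategoryTheory AlgebraicGeometry

namespace Summit.HodgeConjecture.HodgeConjecture.Cruxes.K3TypeNets.PicardDichotomy

open Literature.AlgebraicGeometry.Motives Literature.AlgebraicGeometry.HodgeTheory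
open Summit.HodgeConjecture.HodgeConjecture.Theses.NoetherLefschetzOneUp (K3TypeNets)

/-! ## §1 The six stubs (`sorry` lives ONLY in these six theorems) -/

/-- **Stub S1 — a K3-type fibration of a fourfold over `ℙ²` is a surface net** (size M; theorem in
print; VERBATIM the live line's `stub_netStructure`). For `X` smooth projective of dimension `4`,
`f : X ⟶ ℙ²_ℂ` surjective on points, with smooth projective surface fibres over the `ℂ`-points off a
proper closed `T`: `f` has geometrically connected fibres (Stein factorisation over the normal base `ℙ²`;
Zariski's connectedness theorem, Stacks 0AY8) and wherever `f` is smooth it is smooth of relative dimension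
`2`. [cite: StacksProject, Tag 0AY8] [cite: Hartshorne1977, III Cor. 11.3 and Cor. 11.5, III Prop. 10.4] -/
theorem stub_netStructure :
    ∀ ⦃X : SchemeOver ℂ⦄ (f : X ⟶ projectiveSpace 2 ℂ), IsSmoothProjective 4 X →
      Function.Surjective f.left.base →
      (∃ T : Set (projectiveSpace 2 ℂ).left, IsClosed T ∧ T ≠ Set.univ ∧
        ∀ s : AlgPoints (projectiveSpace 2 ℂ) ℂ, s.pt ∉ T → IsSmoothProjective 2 (fiberOver f s)) →
      GeometricallyConnected f.left ∧
        ∀ U : (projectiveSpace 2 ℂ).left.Opens,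
          Smooth (f.left ∣_ U) → SmoothOfRelativeDimension 2 (f.left ∣_ U) := by
  sorry

/-- **Stub S2a — fibrewise calibration by a multisection class** (size M/L; theorem; VERBATIM the live
line's `stub_fibreClassMultiple`): one rational algebraic `σ ∈ H⁴(X(ℂ); ℂ)` (`h ∪ h`) such that on every
smooth projective fibre every rational class restricts to a RATIONAL multiple of `σ|_{X_s}` (hard
Lefschetz on the surface fibre). [cite: VoisinHodgeI2002, Thm. 6.25 and §7.1.2]
[cite: VoisinHodgeII2003, Prop. 9.21] [cite: Arapura2022, Cor. 1.4 (the edge `H⁰(U, R⁴f_*ℚ)`)] -/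
theorem stub_fibreClassMultiple :
    ∀ ⦃X : SchemeOver ℂ⦄ (f : X ⟶ projectiveSpace 2 ℂ), IsSmoothProjective 4 X →
      ∃ σ : complexBetti X (2 * 2), IsRationalClass σ ∧ σ ∈ algebraicClasses X 2 ∧
        ∀ s : AlgPoints (projectiveSpace 2 ℂ) ℂ, IsSmoothProjective 2 (fiberOver f s) →
          ∀ c : complexBetti X (2 * 2), IsRationalClass c →
            ∃ q : ℚ, complexBetti.map (fiberι f s) (2 * 2) (c - (q : ℂ) • σ) = 0 := by
  sorry

/-- **Stub S2b — fibre-triviality is transported along a smooth open** (size M/L; theorem — Ehresmann;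
VERBATIM the live line's `stub_fibreClassTransport`). [cite: VoisinHodgeI2002, §9.2.1 and Thm. 9.3]
[cite: SGA1, Exp. XII Prop. 2.4] -/
theorem stub_fibreClassTransport :
    ∀ ⦃X : SchemeOver ℂ⦄ (f : X ⟶ projectiveSpace 2 ℂ), IsSmoothProjective 4 X →
      GeometricallyConnected f.left →
      (∀ U : (projectiveSpace 2 ℂ).left.Opens,
        Smooth (f.left ∣_ U) → SmoothOfRelativeDimension 2 (f.left ∣_ U)) →
      ∀ U : (projectiveSpace 2 ℂ).left.Opens, Smooth (f.left ∣_ U) →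
        ∀ c : complexBetti X (2 * 2), ∀ s₀ s : AlgPoints (projectiveSpace 2 ℂ) ℂ,
          s₀.pt ∈ U → s.pt ∈ U →
          complexBetti.map (fiberι f s₀) (2 * 2) c = 0 →
          complexBetti.map (fiberι f s) (2 * 2) c = 0 := by
  sorry

/-- **Stub S3c — the ISOGENY sector: fibre-trivial Hodge classes of a K3-type net with CONSTANT Picard
number** (size XL/open core — NEW in this line). Data: a K3-type net `f : X ⟶ ℙ²` (surjective,
geometrically connected fibres, relative dimension two where smooth), a non-empty open `U ⊆ ℙ²` over which
`f` is SMOOTH, fibres over `U(ℂ)` smooth projective with `h^{2,0} = 1` (regular OR irregular), and ALL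
fibres over `U(ℂ)` with the same Picard number `dim_ℂ span{rational (1,1)-classes}`; conclusion as in the
live S3/S4: every fibre-trivial rational `(2,2)`-class is `a + (c - a)`, `a` rational algebraic, `c - a`
supported over a proper closed `C ⊊ ℙ²`. Reading: no NL point in `U` ⇒ period map constant on `U`
(Green's criterion read backwards) ⇒ the transcendental variation is constant `= T₀` on a finite étale
cover `U' → U` ⇒ the Hodge classes in question are `Hom_Hdg(T₀, gr^W_2 H²(U'))` and must be carried by
multisections alone (NL supply empty). Contains `Hom_Hdg(T(S), T(B))` for bi-double covers
`(S × B)/(ι × τ) → ℙ²` (S a K3 with non-symplectic involution, B any double plane): Buskin / Huybrechts for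
isometries, CM-span; similarities of non-square multiplier and real multiplication OPEN (Varesco 2023).
HC-implied (`a := c`, `C := ∅`). [cite: Buskin2019, Thm. 1.1] [cite: Huybrechts2019, Thm. 0.2 and Rem. 3.3]
[cite: Varesco2023, Introduction and Thm. 1] [cite: VoisinHodgeII2003, Prop. 5.20] -/
theorem stub_isogenySector :
    ∀ ⦃X : SchemeOver ℂ⦄ (f : X ⟶ projectiveSpace 2 ℂ), IsSmoothProjective 4 X →
      Function.Surjective f.left.base → GeometricallyConnected f.left →
      (∀ U : (projectiveSpace 2 ℂ).left.Opens,
        Smooth (f.left ∣_ U) → SmoothOfRelativeDimension 2 (f.left ∣_ U)) →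
      ∀ U : (projectiveSpace 2 ℂ).left.Opens, U ≠ ⊥ → Smooth (f.left ∣_ U) →
        (∀ s : AlgPoints (projectiveSpace 2 ℂ) ℂ, s.pt ∈ U →
          IsSmoothProjective 2 (fiberOver f s) ∧
            ∃ A : HodgeModel 2 (fiberOver f s), Module.finrank ℂ ↥(A.hodgePQ 2 2 0) = 1) →
        (∀ s t : AlgPoints (projectiveSpace 2 ℂ) ℂ, s.pt ∈ U → t.pt ∈ U →
          Module.finrank ℂ ↥(Submodule.span ℂ {x : complexBetti (fiberOver f s) (2 * 1) |
              IsRationalClass x ∧ IsOfHodgeType 2 (fiberOver f s) (2 * 1) 1 1 x}) =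
            Module.finrank ℂ ↥(Submodule.span ℂ {x : complexBetti (fiberOver f t) (2 * 1) |
              IsRationalClass x ∧ IsOfHodgeType 2 (fiberOver f t) (2 * 1) 1 1 x})) →
        ∀ c : complexBetti X (2 * 2), IsRationalClass c → IsOfHodgeType 4 X (2 * 2) 2 2 c →
          (∀ s : AlgPoints (projectiveSpace 2 ℂ) ℂ, s.pt ∈ U →
            complexBetti.map (fiberι f s) (2 * 2) c = 0) →
          ∃ a : complexBetti X (2 * 2), IsRationalClass a ∧ a ∈ algebraicClasses X 2 ∧
            ∃ C : Set (projectiveSpace 2 ℂ).left, IsClosed C ∧ C ≠ Set.univ ∧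
              complexBetti.restrictCompl X (f.left.base ⁻¹' C) (2 * 2) (c - a) = 0 := by
  sorry

/-- **Stub S3j — NL support of fibre-trivial Hodge classes, REGULAR fibres, JUMPING Picard number** (size
XL — the heart of the route's mechanism on its true home). The live S3 (`q = 0` fibres, fibre-trivial
rational `(2,2)`-class over a non-empty smooth open `U`) with ONE extra hypothesis: two fibres over `U(ℂ)`
have different Picard numbers. A Picard jump in `U` is a Noether–Lefschetz point, so the period map is
non-constant and — `h^{2,0} = 1 < 2 = dim ℙ²` — Noether–Lefschetz CURVES exist and are analytically dense
(Green; Oguiso): the supply of vertical algebraic classes `G_{C,v}` (Lefschetz (1,1) on the threefolds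
`f⁻¹C`) is non-empty and dense; the claim is `Hdg ∩ L¹ = span{G_{C,v}} + span{pr[Σ]}` (bi-type
`(1,1)_B ⊗ (1,1)_𝕋` by Kollár's vanishing over `ℙ²`; completeness audited by the pulled-back
García–Kudla–Millson theta series). HC-implied (`a := c`, `C := ∅`); not in print. Calibration families with
`CH₀` on a threefold (X_(1,4), quadric nets of Q⁴, hyperplane nets of quartic fourfolds) are in print here
(Conte–Murre / Bloch–Srinivas); open members have `K_X` pseudo-effective (special X_(3,4) ⊂ ℙ²×ℙ³).
[cite: Arapura2022, Thm. 1.2, Cor. 1.4 and Rmk. 1.6] [cite: Green1989NLComponents]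
[cite: VoisinHodgeII2003, Prop. 5.20 and Prop. 10.26] [cite: Garcia2016, Thm. 1.2] [cite: Kollar1986, Thm. 2.1]
[cite: DeligneHodgeIII1974, Cor. 8.2.8] -/
theorem stub_nlSupportRegularJumping :
    ∀ ⦃X : SchemeOver ℂ⦄ (f : X ⟶ projectiveSpace 2 ℂ), IsSmoothProjective 4 X →
      Function.Surjective f.left.base → GeometricallyConnected f.left →
      (∀ U : (projectiveSpace 2 ℂ).left.Opens,
        Smooth (f.left ∣_ U) → SmoothOfRelativeDimension 2 (f.left ∣_ U)) →
      ∀ U : (projectiveSpace 2 ℂ).left.Opens, U ≠ ⊥ → Smooth (f.left ∣_ U) →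
        (∀ s : AlgPoints (projectiveSpace 2 ℂ) ℂ, s.pt ∈ U →
          IsSmoothProjective 2 (fiberOver f s) ∧
            ∃ A : HodgeModel 2 (fiberOver f s), Module.finrank ℂ ↥(A.hodgePQ 2 2 0) = 1) →
        (∀ s : AlgPoints (projectiveSpace 2 ℂ) ℂ, s.pt ∈ U →
          ∀ A : HodgeModel 2 (fiberOver f s), Module.finrank ℂ ↥(A.hodgePQ 1 1 0) = 0) →
        (∃ s t : AlgPoints (projectiveSpace 2 ℂ) ℂ, s.pt ∈ U ∧ t.pt ∈ U ∧
          Module.finrank ℂ ↥(Submodule.span ℂ {x : complexBetti (fiberOver f s) (2 * 1) |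
              IsRationalClass x ∧ IsOfHodgeType 2 (fiberOver f s) (2 * 1) 1 1 x}) ≠
            Module.finrank ℂ ↥(Submodule.span ℂ {x : complexBetti (fiberOver f t) (2 * 1) |
              IsRationalClass x ∧ IsOfHodgeType 2 (fiberOver f t) (2 * 1) 1 1 x})) →
        ∀ c : complexBetti X (2 * 2), IsRationalClass c → IsOfHodgeType 4 X (2 * 2) 2 2 c →
          (∀ s : AlgPoints (projectiveSpace 2 ℂ) ℂ, s.pt ∈ U →
            complexBetti.map (fiberι f s) (2 * 2) c = 0) →
          ∃ a : complexBetti X (2 * 2), IsRationalClass a ∧ a ∈ algebraicClasses X 2 ∧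
            ∃ C : Set (projectiveSpace 2 ℂ).left, IsClosed C ∧ C ≠ Set.univ ∧
              complexBetti.restrictCompl X (f.left.base ⁻¹' C) (2 * 2) (c - a) = 0 := by
  sorry

/-- **Stub S4j — NL support of fibre-trivial Hodge classes, IRREGULAR fibres, JUMPING Picard number**
(size XL/open — the refuter's regime with supply present). The live S4 (some fibre over `U(ℂ)` has
`h^{1,0} ≠ 0`) with the extra hypothesis "two fibres over `U(ℂ)` have different Picard numbers" (period
map non-constant, NL curves dense). The `E_s × E_t` nets on squares of real-multiplication elliptic K3s
(the parent's why-might-fail; vanGeemen 2008 §3, Huybrechts 2019 Rem. 3.3) are Picard-JUMPING and live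
here, now next to a non-empty NL supply and the Mordell–Weil supply of `H¹(U, R³) ≅ H¹(U, R¹)(-1)`.
HC-implied (`a := c`, `C := ∅`). [cite: Arapura2022, Cor. 1.4] [cite: VanGeemen2008RM, §3]
[cite: Huybrechts2019, Rem. 3.3] [cite: Zucker1977] [cite: VoisinHodgeII2003, Prop. 5.20] -/
theorem stub_nlSupportIrregularJumping :
    ∀ ⦃X : SchemeOver ℂ⦄ (f : X ⟶ projectiveSpace 2 ℂ), IsSmoothProjective 4 X →
      Function.Surjective f.left.base → GeometricallyConnected f.left →
      (∀ U : (projectiveSpace 2 ℂ).left.Opens,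
        Smooth (f.left ∣_ U) → SmoothOfRelativeDimension 2 (f.left ∣_ U)) →
      ∀ U : (projectiveSpace 2 ℂ).left.Opens, U ≠ ⊥ → Smooth (f.left ∣_ U) →
        (∀ s : AlgPoints (projectiveSpace 2 ℂ) ℂ, s.pt ∈ U →
          IsSmoothProjective 2 (fiberOver f s) ∧
            ∃ A : HodgeModel 2 (fiberOver f s), Module.finrank ℂ ↥(A.hodgePQ 2 2 0) = 1) →
        (∃ s : AlgPoints (projectiveSpace 2 ℂ) ℂ, s.pt ∈ U ∧
          ∃ A : HodgeModel 2 (fiberOver f s), Module.finrank ℂ ↥(A.hodgePQ 1 1 0) ≠ 0) →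
        (∃ s t : AlgPoints (projectiveSpace 2 ℂ) ℂ, s.pt ∈ U ∧ t.pt ∈ U ∧
          Module.finrank ℂ ↥(Submodule.span ℂ {x : complexBetti (fiberOver f s) (2 * 1) |
              IsRationalClass x ∧ IsOfHodgeType 2 (fiberOver f s) (2 * 1) 1 1 x}) ≠
            Module.finrank ℂ ↥(Submodule.span ℂ {x : complexBetti (fiberOver f t) (2 * 1) |
              IsRationalClass x ∧ IsOfHodgeType 2 (fiberOver f t) (2 * 1) 1 1 x})) →
        ∀ c : complexBetti X (2 * 2), IsRationalClass c → IsOfHodgeType 4 X (2 * 2) 2 2 c →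
          (∀ s : AlgPoints (projectiveSpace 2 ℂ) ℂ, s.pt ∈ U →
            complexBetti.map (fiberι f s) (2 * 2) c = 0) →
          ∃ a : complexBetti X (2 * 2), IsRationalClass a ∧ a ∈ algebraicClasses X 2 ∧
            ∃ C : Set (projectiveSpace 2 ℂ).left, IsClosed C ∧ C ≠ Set.univ ∧
              complexBetti.restrictCompl X (f.left.base ⁻¹' C) (2 * 2) (c - a) = 0 := by
  sorry

/-! ## §2 Name-keyed statements of the stubs

Each `Registered.stub_*` is VERBATIM the statement of `stub_*` (§4 checks this by definitional unfolding);
the three shared stubs have the same names and statements as in `Lines/birth.lean` v2. -/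

namespace Registered

/-- Statement of `stub_netStructure` (S1), verbatim (shared with the live line). -/
abbrev stub_netStructure : Prop :=
  ∀ ⦃X : SchemeOver ℂ⦄ (f : X ⟶ projectiveSpace 2 ℂ), IsSmoothProjective 4 X →
    Function.Surjective f.left.base →
    (∃ T : Set (projectiveSpace 2 ℂ).left, IsClosed T ∧ T ≠ Set.univ ∧
      ∀ s : AlgPoints (projectiveSpace 2 ℂ) ℂ, s.pt ∉ T → IsSmoothProjective 2 (fiberOver f s)) →
    GeometricallyConnected f.left ∧
      ∀ U : (projectiveSpace 2 ℂ).left.Opens,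
        Smooth (f.left ∣_ U) → SmoothOfRelativeDimension 2 (f.left ∣_ U)

/-- Statement of `stub_fibreClassMultiple` (S2a), verbatim (shared with the live line). -/
abbrev stub_fibreClassMultiple : Prop :=
  ∀ ⦃X : SchemeOver ℂ⦄ (f : X ⟶ projectiveSpace 2 ℂ), IsSmoothProjective 4 X →
    ∃ σ : complexBetti X (2 * 2), IsRationalClass σ ∧ σ ∈ algebraicClasses X 2 ∧
      ∀ s : AlgPoints (projectiveSpace 2 ℂ) ℂ, IsSmoothProjective 2 (fiberOver f s) →
        ∀ c : complexBetti X (2 * 2), IsRationalClass c →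
          ∃ q : ℚ, complexBetti.map (fiberι f s) (2 * 2) (c - (q : ℂ) • σ) = 0

/-- Statement of `stub_fibreClassTransport` (S2b), verbatim (shared with the live line). -/
abbrev stub_fibreClassTransport : Prop :=
  ∀ ⦃X : SchemeOver ℂ⦄ (f : X ⟶ projectiveSpace 2 ℂ), IsSmoothProjective 4 X →
    GeometricallyConnected f.left →
    (∀ U : (projectiveSpace 2 ℂ).left.Opens,
      Smooth (f.left ∣_ U) → SmoothOfRelativeDimension 2 (f.left ∣_ U)) →
    ∀ U : (projectiveSpace 2 ℂ).left.Opens, Smooth (f.left ∣_ U) →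
      ∀ c : complexBetti X (2 * 2), ∀ s₀ s : AlgPoints (projectiveSpace 2 ℂ) ℂ,
        s₀.pt ∈ U → s.pt ∈ U →
        complexBetti.map (fiberι f s₀) (2 * 2) c = 0 →
        complexBetti.map (fiberι f s) (2 * 2) c = 0

/-- Statement of `stub_isogenySector` (S3c), verbatim. -/
abbrev stub_isogenySector : Prop :=
  ∀ ⦃X : SchemeOver ℂ⦄ (f : X ⟶ projectiveSpace 2 ℂ), IsSmoothProjective 4 X →
    Function.Surjective f.left.base → GeometricallyConnected f.left →
    (∀ U : (projectiveSpace 2 ℂ).left.Opens,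
      Smooth (f.left ∣_ U) → SmoothOfRelativeDimension 2 (f.left ∣_ U)) →
    ∀ U : (projectiveSpace 2 ℂ).left.Opens, U ≠ ⊥ → Smooth (f.left ∣_ U) →
      (∀ s : AlgPoints (projectiveSpace 2 ℂ) ℂ, s.pt ∈ U →
        IsSmoothProjective 2 (fiberOver f s) ∧
          ∃ A : HodgeModel 2 (fiberOver f s), Module.finrank ℂ ↥(A.hodgePQ 2 2 0) = 1) →
      (∀ s t : AlgPoints (projectiveSpace 2 ℂ) ℂ, s.pt ∈ U → t.pt ∈ U →
        Module.finrank ℂ ↥(Submodule.span ℂ {x : complexBetti (fiberOver f s) (2 * 1) |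
            IsRationalClass x ∧ IsOfHodgeType 2 (fiberOver f s) (2 * 1) 1 1 x}) =
          Module.finrank ℂ ↥(Submodule.span ℂ {x : complexBetti (fiberOver f t) (2 * 1) |
            IsRationalClass x ∧ IsOfHodgeType 2 (fiberOver f t) (2 * 1) 1 1 x})) →
      ∀ c : complexBetti X (2 * 2), IsRationalClass c → IsOfHodgeType 4 X (2 * 2) 2 2 c →
        (∀ s : AlgPoints (projectiveSpace 2 ℂ) ℂ, s.pt ∈ U →
          complexBetti.map (fiberι f s) (2 * 2) c = 0) →
        ∃ a : complexBetti X (2 * 2), IsRationalClass a ∧ a ∈ algebraicClasses X 2 ∧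
          ∃ C : Set (projectiveSpace 2 ℂ).left, IsClosed C ∧ C ≠ Set.univ ∧
            complexBetti.restrictCompl X (f.left.base ⁻¹' C) (2 * 2) (c - a) = 0

/-- Statement of `stub_nlSupportRegularJumping` (S3j), verbatim. -/
abbrev stub_nlSupportRegularJumping : Prop :=
  ∀ ⦃X : SchemeOver ℂ⦄ (f : X ⟶ projectiveSpace 2 ℂ), IsSmoothProjective 4 X →
    Function.Surjective f.left.base → GeometricallyConnected f.left →
    (∀ U : (projectiveSpace 2 ℂ).left.Opens,
      Smooth (f.left ∣_ U) → SmoothOfRelativeDimension 2 (f.left ∣_ U)) →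
    ∀ U : (projectiveSpace 2 ℂ).left.Opens, U ≠ ⊥ → Smooth (f.left ∣_ U) →
      (∀ s : AlgPoints (projectiveSpace 2 ℂ) ℂ, s.pt ∈ U →
        IsSmoothProjective 2 (fiberOver f s) ∧
          ∃ A : HodgeModel 2 (fiberOver f s), Module.finrank ℂ ↥(A.hodgePQ 2 2 0) = 1) →
      (∀ s : AlgPoints (projectiveSpace 2 ℂ) ℂ, s.pt ∈ U →
        ∀ A : HodgeModel 2 (fiberOver f s), Module.finrank ℂ ↥(A.hodgePQ 1 1 0) = 0) →
      (∃ s t : AlgPoints (projectiveSpace 2 ℂ) ℂ, s.pt ∈ U ∧ t.pt ∈ U ∧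
        Module.finrank ℂ ↥(Submodule.span ℂ {x : complexBetti (fiberOver f s) (2 * 1) |
            IsRationalClass x ∧ IsOfHodgeType 2 (fiberOver f s) (2 * 1) 1 1 x}) ≠
          Module.finrank ℂ ↥(Submodule.span ℂ {x : complexBetti (fiberOver f t) (2 * 1) |
            IsRationalClass x ∧ IsOfHodgeType 2 (fiberOver f t) (2 * 1) 1 1 x})) →
      ∀ c : complexBetti X (2 * 2), IsRationalClass c → IsOfHodgeType 4 X (2 * 2) 2 2 c →
        (∀ s : AlgPoints (projectiveSpace 2 ℂ) ℂ, s.pt ∈ U →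
          complexBetti.map (fiberι f s) (2 * 2) c = 0) →
        ∃ a : complexBetti X (2 * 2), IsRationalClass a ∧ a ∈ algebraicClasses X 2 ∧
          ∃ C : Set (projectiveSpace 2 ℂ).left, IsClosed C ∧ C ≠ Set.univ ∧
            complexBetti.restrictCompl X (f.left.base ⁻¹' C) (2 * 2) (c - a) = 0

/-- Statement of `stub_nlSupportIrregularJumping` (S4j), verbatim. -/
abbrev stub_nlSupportIrregularJumping : Prop :=
  ∀ ⦃X : SchemeOver ℂ⦄ (f : X ⟶ projectiveSpace 2 ℂ), IsSmoothProjective 4 X →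
    Function.Surjective f.left.base → GeometricallyConnected f.left →
    (∀ U : (projectiveSpace 2 ℂ).left.Opens,
      Smooth (f.left ∣_ U) → SmoothOfRelativeDimension 2 (f.left ∣_ U)) →
    ∀ U : (projectiveSpace 2 ℂ).left.Opens, U ≠ ⊥ → Smooth (f.left ∣_ U) →
      (∀ s : AlgPoints (projectiveSpace 2 ℂ) ℂ, s.pt ∈ U →
        IsSmoothProjective 2 (fiberOver f s) ∧
          ∃ A : HodgeModel 2 (fiberOver f s), Module.finrank ℂ ↥(A.hodgePQ 2 2 0) = 1) →
      (∃ s : AlgPoints (projectiveSpace 2 ℂ) ℂ, s.pt ∈ U ∧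
        ∃ A : HodgeModel 2 (fiberOver f s), Module.finrank ℂ ↥(A.hodgePQ 1 1 0) ≠ 0) →
      (∃ s t : AlgPoints (projectiveSpace 2 ℂ) ℂ, s.pt ∈ U ∧ t.pt ∈ U ∧
        Module.finrank ℂ ↥(Submodule.span ℂ {x : complexBetti (fiberOver f s) (2 * 1) |
            IsRationalClass x ∧ IsOfHodgeType 2 (fiberOver f s) (2 * 1) 1 1 x}) ≠
          Module.finrank ℂ ↥(Submodule.span ℂ {x : complexBetti (fiberOver f t) (2 * 1) |
            IsRationalClass x ∧ IsOfHodgeType 2 (fiberOver f t) (2 * 1) 1 1 x})) →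
      ∀ c : complexBetti X (2 * 2), IsRationalClass c → IsOfHodgeType 4 X (2 * 2) 2 2 c →
        (∀ s : AlgPoints (projectiveSpace 2 ℂ) ℂ, s.pt ∈ U →
          complexBetti.map (fiberι f s) (2 * 2) c = 0) →
        ∃ a : complexBetti X (2 * 2), IsRationalClass a ∧ a ∈ algebraicClasses X 2 ∧
          ∃ C : Set (projectiveSpace 2 ℂ).left, IsClosed C ∧ C ≠ Set.univ ∧
            complexBetti.restrictCompl X (f.left.base ⁻¹' C) (2 * 2) (c - a) = 0

end Registered

/-! ## §3 Glue and composition (no `sorry` from here on) -/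

/-- Rational classes are stable under differences (from `IsRationalClass.add/.smul`).
[cite: HatcherAT2002, §3.1] -/
theorem isRationalClass_sub {Y : Type} [TopologicalSpace Y] {k : ℕ}
    {c c' : Literature.AlgebraicTopology.SingularHomology.singularCohomology ℂ ℂ Y k}
    (hc : IsRationalClass c) (hc' : IsRationalClass c') : IsRationalClass (c - c') := by
  have h := hc.add (hc'.smul (-1))
  rwa [Rat.cast_neg, Rat.cast_one, neg_one_smul, ← sub_eq_add_neg] at h

/-- **Two non-empty opens of `ℙ²_ℂ` meet** (`ℙ²` is irreducible). [folklore] -/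
theorem inf_ne_bot_of_projectiveSpace {V W : (projectiveSpace 2 ℂ).left.Opens}
    (hV : (V : Set (projectiveSpace 2 ℂ).left).Nonempty)
    (hW : (W : Set (projectiveSpace 2 ℂ).left).Nonempty) : V ⊓ W ≠ ⊥ := by
  haveI : IsIntegral (projectiveSpace 2 ℂ).left :=
    IsSmoothProjective.isIntegral_holds (isSmoothProjective_projectiveSpace_holds ℂ 2)
  rw [ne_eq, ← TopologicalSpace.Opens.coe_eq_empty, TopologicalSpace.Opens.coe_inf, ← ne_eq,
    ← Set.nonempty_iff_ne_empty]
  exact nonempty_preirreducible_inter V.isOpen W.isOpen hV hW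

/-- **The crux `K3TypeNets` from the six stubs** (implication form; kernel-checked, no `sorry`;
hypotheses keyed to the stubs). Proof: net structure (S1); the tautological surface net
`N := SurfaceNet.ofFibration` and the smooth open `U := Tᶜ ⊓ N.smoothBase` (non-empty, `f` smooth over
it); `span_le`; calibrate the fibre class by a rational multiple of the multisection class `σ` at one
`s₀ ∈ U(ℂ)` (S2a) and transport (S2b); case on the CONSTANCY OF THE PICARD NUMBER over `U(ℂ)`: constant ⇒
S3c (isogeny sector); jumping ⇒ case on regularity ⇒ S3j / S4j (Noether–Lefschetz sector); the residual
is a generator of `V_f`; reassemble `c = (q σ + a) + (c' - a) ∈ algebraicClasses X 2 ⊔ V_f`. -/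
theorem K3TypeNets_of (h₁ : Registered.stub_netStructure) (h₂ : Registered.stub_fibreClassMultiple)
    (h₂' : Registered.stub_fibreClassTransport) (h₃ : Registered.stub_isogenySector)
    (h₄ : Registered.stub_nlSupportRegularJumping) (h₅ : Registered.stub_nlSupportIrregularJumping) :
    K3TypeNets := by
  intro X f hX hf hT
  obtain ⟨T, hTc, hTu, hfib⟩ := hT
  -- S1: the fibration is a surface net (connected fibres, relative dimension two where smooth)
  obtain ⟨hconn, hrel⟩ := h₁ f hX hf ⟨T, hTc, hTu, fun s hs ↦ (hfib s hs).1⟩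
  haveI := hconn
  -- the tautological surface net and the smooth open `U := Tᶜ ⊓ smoothBase`
  let N : SurfaceNet 2 X := SurfaceNet.ofFibration (m := 2) hX f hrel
  let U : (projectiveSpace 2 ℂ).left.Opens := ⟨Tᶜ, hTc.isOpen_compl⟩ ⊓ N.smoothBase
  have hUT : ∀ s : AlgPoints (projectiveSpace 2 ℂ) ℂ, s.pt ∈ U → s.pt ∉ T :=
    fun s hs ↦ (TopologicalSpace.Opens.mem_inf.mp hs).1
  have hUne : U ≠ ⊥ :=
    inf_ne_bot_of_projectiveSpace (Set.nonempty_compl.mpr hTu) N.smoothBase_nonempty_of_charZero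
  haveI : LocallyOfFinitePresentation f.left := N.locallyOfFinitePresentation_proj
  have hUs : Smooth (f.left ∣_ U) :=
    Literature.AlgebraicGeometry.Morphisms.smooth_morphismRestrict_of_preimage_le_smoothLocus
      f.left U fun x hx ↦ N.preimage_smoothBase_le_smoothLocus
        (show x ∈ N.proj.left ⁻¹ᵁ N.smoothBase from (TopologicalSpace.Opens.mem_inf.mp hx).2)
  have hfibU : ∀ s : AlgPoints (projectiveSpace 2 ℂ) ℂ, s.pt ∈ U →
      IsSmoothProjective 2 (fiberOver f s) ∧
        ∃ A : HodgeModel 2 (fiberOver f s), Module.finrank ℂ ↥(A.hodgePQ 2 2 0) = 1 :=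
    fun s hs ↦ hfib s (hUT s hs)
  refine Submodule.span_le.mpr ?_
  rintro c ⟨hcQ, hcH⟩
  -- S2a: the multisection class `σ` and the fibrewise rational multiple
  obtain ⟨σ, hσQ, hσA, hmult⟩ := h₂ f hX
  have hσH : IsOfHodgeType 4 X (2 * 2) 2 2 σ :=
    isOfHodgeType_of_mem_algebraicClasses_of_isSmoothProjective hX 2 hσA
  -- S2a at one point of `U(ℂ)`, transported over `U(ℂ)` by S2b
  obtain ⟨q, hq⟩ : ∃ q : ℚ, ∀ s : AlgPoints (projectiveSpace 2 ℂ) ℂ, s.pt ∈ U →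
      complexBetti.map (fiberι f s) (2 * 2) (c - (q : ℂ) • σ) = 0 := by
    by_cases hne : ∃ s₀ : AlgPoints (projectiveSpace 2 ℂ) ℂ, s₀.pt ∈ U
    · obtain ⟨s₀, hs₀⟩ := hne
      obtain ⟨q, hq₀⟩ := hmult s₀ (hfibU s₀ hs₀).1 c hcQ
      exact ⟨q, fun s hs ↦ h₂' f hX hconn hrel U hUs _ s₀ s hs₀ hs hq₀⟩
    · push Not at hne
      exact ⟨0, fun s hs ↦ (hne s hs).elim⟩
  have hc'Q : IsRationalClass (c - (q : ℂ) • σ) := isRationalClass_sub hcQ (hσQ.smul q)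
  have hc'H : IsOfHodgeType 4 X (2 * 2) 2 2 (c - (q : ℂ) • σ) := hcH.sub hX (hσH.smul _)
  -- S3c / S3j / S4j: a fibre-trivial Hodge class is a multisection combination plus a class supported
  -- over a curve — by the Picard dichotomy, then by regularity
  have key : ∃ a : complexBetti X (2 * 2), IsRationalClass a ∧ a ∈ algebraicClasses X 2 ∧
      ∃ C : Set (projectiveSpace 2 ℂ).left, IsClosed C ∧ C ≠ Set.univ ∧
        complexBetti.restrictCompl X (f.left.base ⁻¹' C) (2 * 2) (c - (q : ℂ) • σ - a) = 0 := by
    by_cases hconst : ∀ s t : AlgPoints (projectiveSpace 2 ℂ) ℂ, s.pt ∈ U → t.pt ∈ U →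
        Module.finrank ℂ ↥(Submodule.span ℂ {x : complexBetti (fiberOver f s) (2 * 1) |
            IsRationalClass x ∧ IsOfHodgeType 2 (fiberOver f s) (2 * 1) 1 1 x}) =
          Module.finrank ℂ ↥(Submodule.span ℂ {x : complexBetti (fiberOver f t) (2 * 1) |
            IsRationalClass x ∧ IsOfHodgeType 2 (fiberOver f t) (2 * 1) 1 1 x})
    · -- the isogeny sector
      exact h₃ f hX hf hconn hrel U hUne hUs hfibU hconst _ hc'Q hc'H hq
    · -- the Noether–Lefschetz sector
      push Not at hconst
      obtain ⟨s₁, t₁, hs₁, ht₁, hne₁⟩ := hconst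
      by_cases hreg : ∀ s : AlgPoints (projectiveSpace 2 ℂ) ℂ, s.pt ∈ U →
          ∀ A : HodgeModel 2 (fiberOver f s), Module.finrank ℂ ↥(A.hodgePQ 1 1 0) = 0
      · exact h₄ f hX hf hconn hrel U hUne hUs hfibU hreg ⟨s₁, t₁, hs₁, ht₁, hne₁⟩ _ hc'Q hc'H hq
      · push Not at hreg
        exact h₅ f hX hf hconn hrel U hUne hUs hfibU hreg ⟨s₁, t₁, hs₁, ht₁, hne₁⟩ _ hc'Q hc'H hq
  obtain ⟨a, haQ, haA, C, hCc, hCu, hCa⟩ := key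
  have haH : IsOfHodgeType 4 X (2 * 2) 2 2 a :=
    isOfHodgeType_of_mem_algebraicClasses_of_isSmoothProjective hX 2 haA
  -- the residual class is VERTICAL: a generator of the route's `V_f`
  have hv : c - (q : ℂ) • σ - a ∈ Submodule.span ℂ {c : complexBetti X (2 * 2) |
      IsRationalClass c ∧ IsOfHodgeType 4 X (2 * 2) 2 2 c ∧
        ∃ T : Set (projectiveSpace 2 ℂ).left, IsClosed T ∧ T ≠ Set.univ ∧
          complexBetti.restrictCompl X (f.left.base ⁻¹' T) (2 * 2) c = 0} :=
    Submodule.subset_span ⟨isRationalClass_sub hc'Q haQ, hc'H.sub hX haH, C, hCc, hCu, hCa⟩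
  -- reassemble `c = (q • σ + a) + (c - q • σ - a)` : algebraic ⊔ vertical
  have hdecomp : c = ((q : ℂ) • σ + a) + (c - (q : ℂ) • σ - a) := by abel
  rw [hdecomp]
  exact Submodule.add_mem _
    (Submodule.mem_sup_left (Submodule.add_mem _ (Submodule.smul_mem _ _ hσA) haA))
    (Submodule.mem_sup_right hv)

/-! ## §4 Wiring check -/

/-- The stubs feed the composition VERBATIM (definitional unfolding only; inherits the six `sorry`s and
is not a proof of the item). -/
theorem k3TypeNets_holds_of_stubs : K3TypeNets :=
  K3TypeNets_of stub_netStructure stub_fibreClassMultiple stub_fibreClassTransport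
    stub_isogenySector stub_nlSupportRegularJumping stub_nlSupportIrregularJumping

end Summit.HodgeConjecture.HodgeConjecture.Cruxes.K3TypeNets.PicardDichotomy

end
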